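import Mathlib
import HarnessLib
import Summits.NavierStokesRegularity.NavierStokesRegularity.Theorems.LocalHelicityTubeDoorLocalPointZoomVelCurlSlices
import Summits.NavierStokesRegularity.NavierStokesRegularity.Theorems.LocalHelicityTubeDoorFrobeniusWindowRigidityWindow

/-!
# Door S11 `LocalTubeDoorHelicity` (nsreg-p1 ROUND-11, the FROBENIUS / helicity-density window door) — THE GLUE
# `K1‴ → K2⁗ → S11` as a tree theorem, and the door modulo its one open profile crux

Cell ns-regularity-ideate, seat p6 (route-directed support for an UNSTAGED door; anchor
`--supports stmt-NavierStokesRegularity-20017`; edge re-pointed at birth).  nsreg-p1's `r11/Sketch11.lean` states the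
route shape `localTubeDoorHelicity_plan : LocalPointZoomVelCurlSlices → FrobeniusWindowRigidity → LocalTubeDoorHelicity`
as a bare `Prop`; here it is PROVED (`localTubeDoorHelicity_of`), with every cell definition unfolded to tree vocabulary
(`IsTypeIProfile` = its four clauses; `TubeHelicityFades u T x₀ U` =
`Tendsto (fun t ↦ ∫⁻ y in U, ofReal |√(T−t)³ · ⟪u t, curl (u t)⟫(x₀ + √(T−t) y)|) (𝓝[<] T) (𝓝 0)`).  The proof is the
Fatou-on-the-window argument of the certified S10 glue (`route-velcomp/glue.lean`, nsreg-p1 g9) run on the PRODUCT of the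
two pointwise-convergent rescaled sequences of K1‴: along the zoom times `tⱼ = T + λⱼ²s/ν → T⁻` the window velocity
`√(T−tⱼ) u(tⱼ, x₀ + √(T−tⱼ)y)` is `σν ×` the rescaled velocity at `σy` and the window vorticity
`(T−tⱼ) curl u(tⱼ)(x₀ + √(T−tⱼ)y)` is `σ²ν ×` the rescaled vorticity at `σy` (`σ = √(−s)/√ν`), so the normalised helicity
density `h̃(tⱼ, y)` converges pointwise to `σ³ν² ⟪v s, curl (v s)⟫(σy)`; Fatou (`lintegral_liminf_le'`) and `∫_U |h̃(tⱼ)| → 0`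
give `⟪v s, curl v s⟫ = 0` a.e. on `σ • U`, hence everywhere on that open window by continuity of the slice helicity
density (`continuous_helicity_slice`) — which is the window hypothesis of K2⁗ at the slice `s`.

* `localTubeDoorHelicity_of` — **the glue**: K1‴ (text of `localPointZoomVelCurlSlices`) → K2⁗ (window form, class
  spelled out) → S11;
* `localTubeDoorHelicity_of_windowRigidity` — S11 ⇐ K2⁗ alone (K1‴ discharged by the tree theorem
  `…LocalHelicityTubeDoorLocalPointZoomVelCurlSlices.localPointZoomVelCurlSlices`);
* `localTubeDoorHelicity_of_profileRigidity` — **S11 ⇐ `FrobeniusProfileRigidity`** (K2⁗'s window → slab support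
  discharged by `…FrobeniusWindowRigidityWindow.helicityWindowToSlab`): the door «local Type I at (x₀,T) + the
  scale-normalised helicity density fades in L¹ over ONE similarity window ⇒ no blow-up at (x₀,T)» holds modulo exactly
  the profile-Liouville statement on the Frobenius class `𝔉 = {v · curl v ≡ 0}` (OPEN; contains KNSS 2009 Thms 5.1/5.2,
  excludes the swirl case).

WHAT THIS IS NOT: not a claim about Navier–Stokes regularity; the certified-glue analogue for a door route that is not
yet staged, CONDITIONAL on its open profile crux which appears as an explicit hypothesis (bears_on LADDER-NS N0).
-/

noncomputable section

-- the summit and its single sub-problem share the name (CONVENTIONS §1), as in every Theorems file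
set_option linter.dupNamespace false

namespace Summit.NavierStokesRegularity.NavierStokesRegularity.Theorems.LocalHelicityTubeDoorTarget

open MeasureTheory Set Function Filter Topology TopologicalSpace Metric
open scoped RealInnerProductSpace InnerProductSpace NNReal ENNReal
open Literature.Analysis Literature.Analysis.FluidPDE
open Summit.NavierStokesRegularity.NavierStokesRegularity.Theorems.LocalHelicityTubeDoorLocalPointZoomVelCurlSlices
open Summit.NavierStokesRegularity.NavierStokesRegularity.Theorems.LocalHelicityTubeDoorFrobeniusWindowRigidityWindow

/-- **THE GLUE `K1‴ → K2⁗ → S11`** (nsreg-p1 ROUND-11 `localTubeDoorHelicity_plan`, PROVED): the local point zoom with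
velocity AND vorticity slices, together with Frobenius window rigidity of Type-I profiles, gives the helicity-density
window door — a classical Leray–Hopf solution from rapidly decaying data that is LOCALLY Type I at `(x₀,T)` and whose
scale-normalised helicity density `√(T−t)³ ⟪u, curl u⟫(t, x₀ + √(T−t)y)` fades in `L¹` over ONE nonempty open similarity
window stays bounded near `x₀` up to time `T`. -/
theorem localTubeDoorHelicity_of
    (h₁ : ∀ (ν T : ℝ), 0 < ν → 0 < T → ∀ (u : ℝ → EuclideanSpace ℝ (Fin 3) → EuclideanSpace ℝ (Fin 3))
        (p : ℝ → EuclideanSpace ℝ (Fin 3) → ℝ),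
      Literature.Analysis.FluidPDE.IsClassicalNSSolutionOn (Set.Ico 0 T) ν 0 u p →
      Literature.Analysis.FluidPDE.IsLerayHopfOn T ν 0 (u 0) u →
      Literature.Analysis.FluidPDE.HasRapidSpatialDecay (u 0) →
      ∀ (x₀ : EuclideanSpace ℝ (Fin 3)) (ρ M : ℝ), 0 < ρ →
      (∀ t ∈ Set.Ico 0 T, T - ρ ^ 2 < t → ∀ x ∈ Metric.ball x₀ ρ, ‖u t x‖ * Real.sqrt (ν * (T - t)) ≤ M) →
      ¬ Literature.Analysis.FluidPDE.IsBackwardBoundedAt u T x₀ →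
      ∃ (C : ℝ) (v : ℝ → EuclideanSpace ℝ (Fin 3) → EuclideanSpace ℝ (Fin 3)) (lam : ℕ → ℝ),
        (∀ j, 0 < lam j) ∧ Filter.Tendsto lam Filter.atTop (nhds 0) ∧
        (Literature.Analysis.FluidPDE.HasTypeITimeDecay C v ∧
          ContinuousOn (Function.uncurry v) (Set.Iio (0 : ℝ) ×ˢ Set.univ) ∧
          (∀ s t : ℝ, s < t → t < 0 → ∀ x, v t x =
            Literature.Analysis.UnboundedOperators.heatExtension (v s) (t - s) x -
              Literature.Analysis.FluidPDE.oseenDuhamel 1 s v v t x) ∧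
          (∀ t < 0, Literature.Analysis.FluidPDE.VectorCalculus.IsDivFree (v t))) ∧
        Literature.Analysis.FluidPDE.IsBackwardSingularPoint v 0 ∧
        ∀ s < 0, ∀ y,
          Filter.Tendsto (fun j => (lam j / ν) • u (T + lam j ^ 2 * s / ν) (x₀ + lam j • y)) Filter.atTop
            (nhds (v s y)) ∧
          Filter.Tendsto (fun j => (lam j ^ 2 / ν) •
            Literature.Analysis.FluidPDE.curl (u (T + lam j ^ 2 * s / ν)) (x₀ + lam j • y)) Filter.atTop
            (nhds (Literature.Analysis.FluidPDE.curl (v s) y)))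
    (h₂ : ∀ (C : ℝ) (v : ℝ → EuclideanSpace ℝ (Fin 3) → EuclideanSpace ℝ (Fin 3)),
      Literature.Analysis.FluidPDE.HasTypeITimeDecay C v →
      ContinuousOn (Function.uncurry v) (Set.Iio (0 : ℝ) ×ˢ Set.univ) →
      (∀ s t : ℝ, s < t → t < 0 → ∀ x, v t x =
        Literature.Analysis.UnboundedOperators.heatExtension (v s) (t - s) x -
          Literature.Analysis.FluidPDE.oseenDuhamel 1 s v v t x) →
      (∀ t < 0, Literature.Analysis.FluidPDE.VectorCalculus.IsDivFree (v t)) →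
      (∀ s < 0, ∃ U : Set (EuclideanSpace ℝ (Fin 3)), IsOpen U ∧ U.Nonempty ∧
        ∀ y ∈ U, ⟪v s y, Literature.Analysis.FluidPDE.curl (v s) y⟫_ℝ = 0) →
      ¬ Literature.Analysis.FluidPDE.IsBackwardSingularPoint v 0) :
    ∀ (ν T : ℝ), 0 < ν → 0 < T → ∀ (u : ℝ → EuclideanSpace ℝ (Fin 3) → EuclideanSpace ℝ (Fin 3))
      (p : ℝ → EuclideanSpace ℝ (Fin 3) → ℝ),
    Literature.Analysis.FluidPDE.IsClassicalNSSolutionOn (Set.Ico 0 T) ν 0 u p →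
    Literature.Analysis.FluidPDE.IsLerayHopfOn T ν 0 (u 0) u →
    Literature.Analysis.FluidPDE.HasRapidSpatialDecay (u 0) →
    ∀ (x₀ : EuclideanSpace ℝ (Fin 3)) (ρ M : ℝ), 0 < ρ →
    (∀ t ∈ Set.Ico 0 T, T - ρ ^ 2 < t → ∀ x ∈ Metric.ball x₀ ρ, ‖u t x‖ * Real.sqrt (ν * (T - t)) ≤ M) →
    ∀ (U : Set (EuclideanSpace ℝ (Fin 3))), IsOpen U → U.Nonempty →
    Filter.Tendsto (fun t => ∫⁻ y in U, ENNReal.ofReal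
      |Real.sqrt (T - t) ^ 3 * ⟪u t (x₀ + Real.sqrt (T - t) • y),
        Literature.Analysis.FluidPDE.curl (u t) (x₀ + Real.sqrt (T - t) • y)⟫_ℝ|)
      (nhdsWithin T (Set.Iio T)) (nhds 0) →
    Literature.Analysis.FluidPDE.IsBackwardBoundedAt u T x₀ := by
  intro ν T hν hT u p hcl hLH hdec x₀ ρ M hρ hM U hU hUne hfade
  by_contra hnot
  obtain ⟨C, v, lam, hlam, hlam0, ⟨hrate, hcont, hmild, hdiv⟩, hsing, hconv⟩ :=
    h₁ ν T hν hT u p hcl hLH hdec x₀ ρ M hρ hM hnot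
  refine h₂ C v hrate hcont hmild hdiv (fun s hs => ?_) hsing
  -- ## fix a slice `s < 0`; zoom times `tⱼ = T + λⱼ² s/ν → T⁻`
  have hns : 0 < -s := neg_pos.2 hs
  obtain ⟨t, ht⟩ : ∃ t : ℕ → ℝ, ∀ j, t j = T + lam j ^ 2 * s / ν := ⟨_, fun j => rfl⟩
  have hTt : ∀ j, T - t j = lam j ^ 2 * (-s) / ν := fun j => by rw [ht j]; ring
  have hc : ∀ j, 0 < lam j ^ 2 * (-s) / ν := fun j => div_pos (mul_pos (pow_pos (hlam j) 2) hns) hν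
  have hc0 : Tendsto (fun j => lam j ^ 2 * (-s) / ν) atTop (𝓝 0) := by
    simpa using ((hlam0.pow 2).mul_const (-s)).div_const ν
  have htT : Tendsto t atTop (𝓝[<] T) := by
    refine tendsto_nhdsWithin_iff.2 ⟨?_, Eventually.of_forall fun j => ?_⟩
    · have h1 : Tendsto (fun j => T - lam j ^ 2 * (-s) / ν) atTop (𝓝 (T - 0)) :=
        tendsto_const_nhds.sub hc0
      rw [sub_zero] at h1
      refine h1.congr fun j => ?_
      rw [ht j]; ring
    · show t j < T
      have h1 := hc j
      rw [← hTt j] at h1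
      linarith
  -- eventually the zoom times lie in `(0, T)`, where `u(tⱼ)` is smooth; shift the sequence there
  have hev : ∀ᶠ j in atTop, t j ∈ Set.Ioo 0 T := htT.eventually (Ioo_mem_nhdsLT hT)
  obtain ⟨j₀, hj₀⟩ := eventually_atTop.1 hev
  have hshift : Tendsto (fun j : ℕ => j + j₀) atTop atTop := tendsto_add_atTop_nat j₀
  -- the fading hypothesis along the (shifted) zoom times
  have hfadej : Tendsto (fun j => ∫⁻ y in U, ENNReal.ofReal
      |Real.sqrt (T - t (j + j₀)) ^ 3 * ⟪u (t (j + j₀)) (x₀ + Real.sqrt (T - t (j + j₀)) • y),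
        curl (u (t (j + j₀))) (x₀ + Real.sqrt (T - t (j + j₀)) • y)⟫_ℝ|)
      atTop (𝓝 0) := (hfade.comp htT).comp hshift
  -- ## the similarity scale along the zoom: `√(T − tⱼ) = λⱼ σ`, `σ = √(−s)/√ν`
  set σ : ℝ := Real.sqrt (-s) / Real.sqrt ν with hσ
  have hσpos : 0 < σ := div_pos (Real.sqrt_pos.2 hns) (Real.sqrt_pos.2 hν)
  have hσ2 : σ ^ 2 = -s / ν := by
    rw [hσ, div_pow, Real.sq_sqrt hns.le, Real.sq_sqrt hν.le]
  have hsq : ∀ j, Real.sqrt (T - t j) = lam j * σ := by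
    intro j
    rw [hTt j, hσ, Real.sqrt_div' _ hν.le, Real.sqrt_mul (pow_nonneg (hlam j).le 2),
      Real.sqrt_sq (hlam j).le]
    ring
  -- the window velocity at time `tⱼ` is `σν ×` the zoom velocity at the point `σ y`
  set W : ℕ → EuclideanSpace ℝ (Fin 3) → EuclideanSpace ℝ (Fin 3) := fun j y =>
    Real.sqrt (T - t (j + j₀)) • u (t (j + j₀)) (x₀ + Real.sqrt (T - t (j + j₀)) • y) with hWdef
  have hW : ∀ (j : ℕ) (y : EuclideanSpace ℝ (Fin 3)), W j y =
      (σ * ν) • ((lam (j + j₀) / ν) • u (T + lam (j + j₀) ^ 2 * s / ν)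
        (x₀ + lam (j + j₀) • (σ • y))) := by
    intro j y
    simp only [hWdef, hsq (j + j₀), smul_smul]
    rw [ht (j + j₀)]
    congr 1
    field_simp
  -- the window vorticity at time `tⱼ` is `σ²ν ×` the zoom vorticity at the point `σ y`
  set Z : ℕ → EuclideanSpace ℝ (Fin 3) → EuclideanSpace ℝ (Fin 3) := fun j y =>
    Real.sqrt (T - t (j + j₀)) ^ 2 • curl (u (t (j + j₀))) (x₀ + Real.sqrt (T - t (j + j₀)) • y) with hZdef
  have hZ : ∀ (j : ℕ) (y : EuclideanSpace ℝ (Fin 3)), Z j y =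
      (σ ^ 2 * ν) • ((lam (j + j₀) ^ 2 / ν) • curl (u (T + lam (j + j₀) ^ 2 * s / ν))
        (x₀ + lam (j + j₀) • (σ • y))) := by
    intro j y
    simp only [hZdef, hsq (j + j₀), smul_smul]
    rw [ht (j + j₀)]
    congr 1
    field_simp
  -- the normalised helicity density is the inner product of the two
  have hWZ : ∀ (j : ℕ) (y : EuclideanSpace ℝ (Fin 3)),
      Real.sqrt (T - t (j + j₀)) ^ 3 * ⟪u (t (j + j₀)) (x₀ + Real.sqrt (T - t (j + j₀)) • y),
        curl (u (t (j + j₀))) (x₀ + Real.sqrt (T - t (j + j₀)) • y)⟫_ℝ = ⟪W j y, Z j y⟫_ℝ := by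
    intro j y
    simp only [hWdef, hZdef, real_inner_smul_left, real_inner_smul_right]
    ring
  -- ## the limit slice helicity density in window coordinates
  set Hs : EuclideanSpace ℝ (Fin 3) → ℝ := fun y =>
    ⟪(σ * ν) • v s (σ • y), (σ ^ 2 * ν) • curl (v s) (σ • y)⟫_ℝ with hHsdef
  have hHs : ∀ y, Hs y = (σ * ν) * (σ ^ 2 * ν) * ⟪v s (σ • y), curl (v s) (σ • y)⟫_ℝ := by
    intro y
    simp only [hHsdef, real_inner_smul_left, real_inner_smul_right]
    ring
  have hHscont : Continuous Hs := by
    rw [show Hs = fun y => (σ * ν) * (σ ^ 2 * ν) * ⟪v s (σ • y), curl (v s) (σ • y)⟫_ℝ from funext hHs]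
    exact continuous_const.mul
      ((continuous_helicity_slice hrate hcont hmild hs).comp (continuous_const_smul σ))
  have hconvW : ∀ y, Tendsto (fun j => W j y) atTop (𝓝 ((σ * ν) • v s (σ • y))) := by
    intro y
    have h := (((hconv s hs (σ • y)).1).comp hshift).const_smul (σ * ν)
    exact h.congr fun j => (hW j y).symm
  have hconvZ : ∀ y, Tendsto (fun j => Z j y) atTop (𝓝 ((σ ^ 2 * ν) • curl (v s) (σ • y))) := by
    intro y
    have h := (((hconv s hs (σ • y)).2).comp hshift).const_smul (σ ^ 2 * ν)
    exact h.congr fun j => (hZ j y).symm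
  have hconvH : ∀ y, Tendsto (fun j => ⟪W j y, Z j y⟫_ℝ) atTop (𝓝 (Hs y)) :=
    fun y => (hconvW y).inner (hconvZ y)
  -- measurability of the `W j`, `Z j`: `u(tⱼ)` is smooth for the shifted times
  have hmem : ∀ j, t (j + j₀) ∈ Set.Ico 0 T := fun j =>
    ⟨(hj₀ (j + j₀) (Nat.le_add_left _ _)).1.le, (hj₀ (j + j₀) (Nat.le_add_left _ _)).2⟩
  have hφ : ∀ j, Continuous fun y : EuclideanSpace ℝ (Fin 3) => x₀ + Real.sqrt (T - t (j + j₀)) • y :=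
    fun j => continuous_const.add (continuous_const_smul _)
  have hWc : ∀ j, Continuous (W j) := fun j => by
    show Continuous fun y => Real.sqrt (T - t (j + j₀)) • u (t (j + j₀)) (x₀ + Real.sqrt (T - t (j + j₀)) • y)
    exact ((hcl.contDiff_velocity (hmem j)).continuous.comp (hφ j)).const_smul (Real.sqrt (T - t (j + j₀)))
  have hZc : ∀ j, Continuous (Z j) := fun j => by
    show Continuous fun y =>
      Real.sqrt (T - t (j + j₀)) ^ 2 • curl (u (t (j + j₀))) (x₀ + Real.sqrt (T - t (j + j₀)) • y)
    exact ((continuous_curl ((hcl.contDiff_velocity (hmem j)).of_le (by norm_cast))).comp (hφ j)).const_smul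
      (Real.sqrt (T - t (j + j₀)) ^ 2)
  -- ## FATOU: the faded helicity density vanishes on the window in the limit
  set g : EuclideanSpace ℝ (Fin 3) → ℝ≥0∞ := fun y => ENNReal.ofReal |Hs y| with hg
  have hgc : Continuous g := ENNReal.continuous_ofReal.comp (continuous_abs.comp hHscont)
  have hgjm : ∀ j, Measurable fun y => ENNReal.ofReal |⟪W j y, Z j y⟫_ℝ| :=
    fun j => (ENNReal.continuous_ofReal.comp (continuous_abs.comp ((hWc j).inner (hZc j)))).measurable
  have hptw : ∀ y, Tendsto (fun j => ENNReal.ofReal |⟪W j y, Z j y⟫_ℝ|) atTop (𝓝 (g y)) :=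
    fun y => ENNReal.tendsto_ofReal ((continuous_abs.tendsto (Hs y)).comp (hconvH y))
  have hF : ∫⁻ y in U, liminf (fun j => ENNReal.ofReal |⟪W j y, Z j y⟫_ℝ|) atTop ≤
      liminf (fun j => ∫⁻ y in U, ENNReal.ofReal |⟪W j y, Z j y⟫_ℝ|) atTop :=
    lintegral_liminf_le' (fun j => (hgjm j).aemeasurable)
  have hlim : (fun y => liminf (fun j => ENNReal.ofReal |⟪W j y, Z j y⟫_ℝ|) atTop) = g :=
    funext fun y => (hptw y).liminf_eq
  have hfadeW : Tendsto (fun j => ∫⁻ y in U, ENNReal.ofReal |⟪W j y, Z j y⟫_ℝ|) atTop (𝓝 0) := by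
    refine hfadej.congr fun j => ?_
    exact lintegral_congr fun y => by rw [hWZ j y]
  rw [hlim, hfadeW.liminf_eq] at hF
  have hint : ∫⁻ y in U, g y = 0 := le_antisymm hF bot_le
  have hae : ∀ᵐ y ∂(volume.restrict U), g y = 0 := (lintegral_eq_zero_iff hgc.measurable).1 hint
  rw [ae_restrict_iff' hU.measurableSet] at hae
  have hzero : ∀ y ∈ U, g y = 0 := by
    intro y hy
    by_contra hne
    set O : Set (EuclideanSpace ℝ (Fin 3)) := U ∩ g ⁻¹' (Ioi 0) with hO
    have hOo : IsOpen O := hU.inter (isOpen_Ioi.preimage hgc)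
    have hO0 : volume O = 0 := by
      rw [measure_eq_zero_iff_ae_notMem]
      filter_upwards [hae] with y' hy'
      rintro ⟨h1, h2⟩
      have := hy' h1
      simp only [mem_preimage, mem_Ioi, this, lt_self_iff_false] at h2
    have hOe : O = ∅ := (hOo.measure_eq_zero_iff volume).1 hO0
    have hyO : y ∈ O := ⟨hy, by simpa [mem_preimage, mem_Ioi, pos_iff_ne_zero] using hne⟩
    rw [hOe] at hyO
    exact hyO
  -- ## back to profile coordinates: the window `σ • U`
  refine ⟨(fun z => σ⁻¹ • z) ⁻¹' U, hU.preimage (continuous_const_smul σ⁻¹), ?_, fun z hz => ?_⟩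
  · obtain ⟨u₀, hu₀⟩ := hUne
    refine ⟨σ • u₀, ?_⟩
    show σ⁻¹ • (σ • u₀) ∈ U
    rwa [smul_smul, inv_mul_cancel₀ hσpos.ne', one_smul]
  · have h := hzero (σ⁻¹ • z) hz
    simp only [hg, ENNReal.ofReal_eq_zero] at h
    have h0 : Hs (σ⁻¹ • z) = 0 := abs_eq_zero.1 (le_antisymm h (abs_nonneg _))
    rw [hHs, smul_smul, mul_inv_cancel₀ hσpos.ne', one_smul] at h0
    exact (mul_eq_zero.1 h0).resolve_left
      (mul_ne_zero (mul_ne_zero hσpos.ne' hν.ne') (mul_ne_zero (pow_ne_zero 2 hσpos.ne') hν.ne'))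

/-- **S11 ⇐ K2⁗** (the zoom crux K1‴ discharged by the tree theorem `localPointZoomVelCurlSlices`): Frobenius window
rigidity of Type-I profiles alone implies the helicity-density window door. -/
theorem localTubeDoorHelicity_of_windowRigidity
    (h₂ : ∀ (C : ℝ) (v : ℝ → EuclideanSpace ℝ (Fin 3) → EuclideanSpace ℝ (Fin 3)),
      Literature.Analysis.FluidPDE.HasTypeITimeDecay C v →
      ContinuousOn (Function.uncurry v) (Set.Iio (0 : ℝ) ×ˢ Set.univ) →
      (∀ s t : ℝ, s < t → t < 0 → ∀ x, v t x =
        Literature.Analysis.UnboundedOperators.heatExtension (v s) (t - s) x -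
          Literature.Analysis.FluidPDE.oseenDuhamel 1 s v v t x) →
      (∀ t < 0, Literature.Analysis.FluidPDE.VectorCalculus.IsDivFree (v t)) →
      (∀ s < 0, ∃ U : Set (EuclideanSpace ℝ (Fin 3)), IsOpen U ∧ U.Nonempty ∧
        ∀ y ∈ U, ⟪v s y, Literature.Analysis.FluidPDE.curl (v s) y⟫_ℝ = 0) →
      ¬ Literature.Analysis.FluidPDE.IsBackwardSingularPoint v 0) :
    ∀ (ν T : ℝ), 0 < ν → 0 < T → ∀ (u : ℝ → EuclideanSpace ℝ (Fin 3) → EuclideanSpace ℝ (Fin 3))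
      (p : ℝ → EuclideanSpace ℝ (Fin 3) → ℝ),
    Literature.Analysis.FluidPDE.IsClassicalNSSolutionOn (Set.Ico 0 T) ν 0 u p →
    Literature.Analysis.FluidPDE.IsLerayHopfOn T ν 0 (u 0) u →
    Literature.Analysis.FluidPDE.HasRapidSpatialDecay (u 0) →
    ∀ (x₀ : EuclideanSpace ℝ (Fin 3)) (ρ M : ℝ), 0 < ρ →
    (∀ t ∈ Set.Ico 0 T, T - ρ ^ 2 < t → ∀ x ∈ Metric.ball x₀ ρ, ‖u t x‖ * Real.sqrt (ν * (T - t)) ≤ M) →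
    ∀ (U : Set (EuclideanSpace ℝ (Fin 3))), IsOpen U → U.Nonempty →
    Filter.Tendsto (fun t => ∫⁻ y in U, ENNReal.ofReal
      |Real.sqrt (T - t) ^ 3 * ⟪u t (x₀ + Real.sqrt (T - t) • y),
        Literature.Analysis.FluidPDE.curl (u t) (x₀ + Real.sqrt (T - t) • y)⟫_ℝ|)
      (nhdsWithin T (Set.Iio T)) (nhds 0) →
    Literature.Analysis.FluidPDE.IsBackwardBoundedAt u T x₀ :=
  localTubeDoorHelicity_of localPointZoomVelCurlSlices h₂

/-- **S11 ⇐ `FrobeniusProfileRigidity`** — the helicity-density window door modulo its ONE open profile crux: if every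
Type-I-rate, continuous, Oseen-mild, divergence-free profile on `(−∞,0) × ℝ³` with `v · curl v ≡ 0` on every slice is
not backward-singular at the apex, then a classical Leray–Hopf solution from rapidly decaying data, LOCALLY Type I at
`(x₀,T)`, whose scale-normalised helicity density fades in `L¹` over one nonempty open similarity window, stays bounded
near `x₀` up to `T` (zoom K1‴ and window → slab both discharged in the tree). -/
theorem localTubeDoorHelicity_of_profileRigidity
    (hprofile : ∀ (C : ℝ) (v : ℝ → EuclideanSpace ℝ (Fin 3) → EuclideanSpace ℝ (Fin 3)),
      Literature.Analysis.FluidPDE.HasTypeITimeDecay C v →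
      ContinuousOn (Function.uncurry v) (Set.Iio (0 : ℝ) ×ˢ Set.univ) →
      (∀ s t : ℝ, s < t → t < 0 → ∀ x, v t x =
        Literature.Analysis.UnboundedOperators.heatExtension (v s) (t - s) x -
          Literature.Analysis.FluidPDE.oseenDuhamel 1 s v v t x) →
      (∀ t < 0, Literature.Analysis.FluidPDE.VectorCalculus.IsDivFree (v t)) →
      (∀ s < 0, ∀ y : EuclideanSpace ℝ (Fin 3), ⟪v s y, Literature.Analysis.FluidPDE.curl (v s) y⟫_ℝ = 0) →
      ¬ Literature.Analysis.FluidPDE.IsBackwardSingularPoint v 0) :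
    ∀ (ν T : ℝ), 0 < ν → 0 < T → ∀ (u : ℝ → EuclideanSpace ℝ (Fin 3) → EuclideanSpace ℝ (Fin 3))
      (p : ℝ → EuclideanSpace ℝ (Fin 3) → ℝ),
    Literature.Analysis.FluidPDE.IsClassicalNSSolutionOn (Set.Ico 0 T) ν 0 u p →
    Literature.Analysis.FluidPDE.IsLerayHopfOn T ν 0 (u 0) u →
    Literature.Analysis.FluidPDE.HasRapidSpatialDecay (u 0) →
    ∀ (x₀ : EuclideanSpace ℝ (Fin 3)) (ρ M : ℝ), 0 < ρ →
    (∀ t ∈ Set.Ico 0 T, T - ρ ^ 2 < t → ∀ x ∈ Metric.ball x₀ ρ, ‖u t x‖ * Real.sqrt (ν * (T - t)) ≤ M) →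
    ∀ (U : Set (EuclideanSpace ℝ (Fin 3))), IsOpen U → U.Nonempty →
    Filter.Tendsto (fun t => ∫⁻ y in U, ENNReal.ofReal
      |Real.sqrt (T - t) ^ 3 * ⟪u t (x₀ + Real.sqrt (T - t) • y),
        Literature.Analysis.FluidPDE.curl (u t) (x₀ + Real.sqrt (T - t) • y)⟫_ℝ|)
      (nhdsWithin T (Set.Iio T)) (nhds 0) →
    Literature.Analysis.FluidPDE.IsBackwardBoundedAt u T x₀ :=
  localTubeDoorHelicity_of_windowRigidity (frobeniusWindowRigidity_of_profileRigidity hprofile)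

end Summit.NavierStokesRegularity.NavierStokesRegularity.Theorems.LocalHelicityTubeDoorTarget

end
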